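import Summits.MatrixMultiplication.OmegaCensus.STPP211TFirstEngine

/-!
# ω-census, `(2,1,1)^k` T-first kernel engine v1.5: exact most-constrained-lane branching at shallow depth

HONEST FRAMING (pub-omega census; verbatim): lottery ticket; floor = certified bounds/negative ranges.
Census STRUCTURE bookkeeping of the STPP track (seat pub-omega-stpp-1, gen 38; STRUCTURE row B5), not progress on `ω`.

Same search as `STPP211TFirstEngine.lean` (same T-phase, same state, same kill patterns, same death tests) with ONE change of
branching heuristic — the P-145 "lever": at placement depth `≤ 4` the lane with the FEWEST allowed codes is branched on (exact
popcounts through an 8-bit table `PT`), deeper nodes use v1's `chooseBit`.  Mirror `kmirror3.c` (HOME `pub-omega-stpp-1-g38/code/`):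
ℤ/33 at `K = 7` 26.2 M → 17.9 M placement nodes, ℤ/30 8.3 M → 6.0 M.  The chooser has no soundness content (the reflection
`…Reflect2` only uses the re-check that the chosen lane is open), so `…ReflectA–C`, `E`, `F` serve unchanged.

References: H. Cohn, R. Kleinberg, B. Szegedy, C. Umans, FOCS 2005 (arXiv:math/0511460), Def. 5.1.
-/

namespace Summit.MatrixMultiplication.OmegaCensus

namespace STPP211T

open STPP211Neg (force lowBit allBits lowMask)

/-- The 8-bit popcount table `Σ_{v<256} popcount(v)·2^{8v}`. -/
noncomputable def popTable : ℕ :=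
  @Nat.rec (fun _ => ℕ) 0 (fun v acc => force acc fun acc' => Nat.lor acc' (Nat.shiftLeft (popc 8 v) (Nat.mul 8 v))) 256

/-- Popcount of a lane content `v < 2^64` by eight table reads. -/
def popc8 (PT v : ℕ) : ℕ :=
  @Nat.rec (fun _ => ℕ) 0
    (fun i acc => Nat.add acc (Nat.land (Nat.shiftRight PT (Nat.mul 8 (Nat.land (Nat.shiftRight v (Nat.mul 8 i)) 255))) 255)) 8

/-- MOST-CONSTRAINED OPEN LANE: scan lanes `0 … K−1`, keep the open one (sentinel in `S`) with the fewest allowed codes (ties: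
the lower lane); returns its sentinel bit (`best = count·2^{KW+64+…}`-free encoding: we carry `(count, bit)` as `count·B + bit`
with `B = 2^{64 + KW}` exceeding every sentinel). -/
noncomputable def chooseDyn (c : TC) (PT M S : ℕ) : ℕ :=
  force (Nat.shiftLeft 1 (Nat.add 64 c.KW)) fun B =>
  Nat.mod (@Nat.rec (fun _ => ℕ) (Nat.mul 255 B)
    (fun l best => force best fun b =>
      force (Nat.shiftLeft 1 (Nat.add (Nat.add 64 (Nat.mul (Nat.sub (Nat.sub c.K 1) l) c.W)) c.n)) fun sb =>
      @Bool.rec (fun _ => ℕ) b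
        (force (popc8 PT (laneVal c M sb)) fun cnt =>
          @Bool.rec (fun _ => ℕ) b (Nat.add (Nat.mul cnt B) sb) (Nat.ble cnt (Nat.div b B)))
        (Nat.beq (Nat.land S sb) sb)) c.K) B

/-- ONE NODE (v1 `pnode` with the depth-dependent chooser; `d` = placements made so far, the first placement counted). -/
noncomputable def pnode2 (c : TC) (PT EPup : ℕ) (rec : ℕ → ℕ → ℕ → ℕ → Bool) (d M S1 S2 : ℕ) : Bool :=
  force (Nat.sub M c.ones) fun t1 =>
  force (Nat.land t1 S1) fun A0 =>
  (!(Nat.beq A0 S1) && Nat.beq (laneVal c M (lowBit (Nat.xor S1 A0))) 0) ||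
  force (Nat.lor (Nat.land M t1) c.sent) fun Y =>
  force (Nat.sub Y c.ones) fun t2 =>
  force (Nat.land t2 S2) fun B0 =>
  (!(Nat.beq B0 S2) &&
    force (laneVal c M (lowBit (Nat.xor S2 B0))) fun v => Nat.beq (Nat.land v (Nat.sub v 1)) 0) ||
  force (Nat.lor S1 S2) fun S =>
  (!(Nat.beq S 0) &&
    force (@Bool.rec (fun _ => ℕ) (lowBit (chooseBit c t2 Y S1 S2 S)) (chooseDyn c PT M S) (Nat.ble d 4)) fun sb =>
    (!(Nat.beq sb 0) && Nat.beq (Nat.land sb (Nat.sub sb 1)) 0 && Nat.beq (Nat.land S sb) sb) &&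
    force (Nat.shiftLeft (Nat.land (Nat.div EPup (Nat.pow sb c.K)) c.allKW) 64) fun EPl =>
    force (Nat.mod sb 2305843009213693951) fun tg =>
    force (Nat.add d 1) fun d' =>
    children c (rec d') M S1 S2 sb EPl tg)

/-- THE PLACEMENT SEARCH v1.5 (fuel, depth, state). -/
noncomputable def psearch2 (c : TC) (PT EPup : ℕ) : ℕ → ℕ → ℕ → ℕ → ℕ → Bool :=
  @Nat.rec (fun _ => ℕ → ℕ → ℕ → ℕ → Bool) (fun _ _ _ _ => false) (fun _ ih d M S1 S2 => pnode2 c PT EPup ih d M S1 S2)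

/-- THE LEAF v1.5 (v1 `tleaf` calling `psearch2` at depth `1`). -/
noncomputable def tleaf2 (c : TC) (PT : ℕ) (L : List ℕ) (PM : ℕ) : Bool :=
  force (negMask c L) fun NM =>
  force (orderCodes c L PM NM) fun OC =>
  orderOK c PM OC &&
  force (epAll c PM NM OC) fun EP =>
  force (Nat.lor (Nat.shiftLeft EP c.upK) PM) fun EPup =>
  force (Nat.pow 2 (Nat.add (Nat.add 64 (Nat.mul 0 (Nat.mul 2 c.n))) c.n)) fun sb0 =>
  force (Nat.shiftLeft (Nat.land (Nat.div EPup (Nat.pow sb0 c.K)) c.allKW) 64) fun EPl0 =>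
  force (Nat.land (Nat.shiftRight (Nat.mul EPl0 (Nat.pow 2 0)) c.n) c.lown) fun K0 =>
  force (Nat.xor (Nat.land (Nat.land c.call (Nat.xor c.call K0)) c.cut0) PM) fun M =>
  force (Nat.xor c.sent sb0) fun S2 =>
  psearch2 c PT EPup c.fuel 1 M sb0 S2

/-- T-phase below a prefix (v1 `tnode`, leaf `tleaf2`). -/
noncomputable def tsearch2 (c : TC) (PT : ℕ) : ℕ → List ℕ → ℕ → Bool :=
  @Nat.rec (fun _ => List ℕ → ℕ → Bool) (fun L PM => tleaf2 c PT L PM) (fun _ ih L PM => tnode c ih L PM)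

/-- Below one root. -/
noncomputable def rootSearch2 (c : TC) (PT : ℕ) (L : List ℕ) : Bool :=
  force (Nat.sub c.K (lengthL L)) fun r => force (maskL L) fun PM => tsearch2 c PT r L PM

/-- Below a list of roots. -/
noncomputable def tsearchRoots2 (c : TC) (PT : ℕ) (roots : List (List ℕ)) : Bool :=
  @List.rec (List ℕ) (fun _ => Bool) true (fun L _ ih => rootSearch2 c PT L && ih) roots

/-- `tsearchRoots2` on a cons. -/
theorem tsearchRoots2_cons (c : TC) (PT : ℕ) (L : List ℕ) (R : List (List ℕ)) :
    tsearchRoots2 c PT (L :: R) = (rootSearch2 c PT L && tsearchRoots2 c PT R) := rfl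

/-- `tsearchRoots2` is a conjunction over the root list. -/
theorem tsearchRoots2_append (c : TC) (PT : ℕ) (R₁ R₂ : List (List ℕ)) :
    tsearchRoots2 c PT (R₁ ++ R₂) = (tsearchRoots2 c PT R₁ && tsearchRoots2 c PT R₂) := by
  induction R₁ with
  | nil => rfl
  | cons L R ih => rw [List.cons_append, tsearchRoots2_cons, tsearchRoots2_cons, ih, Bool.and_assoc]

/-- KERNEL STATEMENT v1.5: the searches below the listed roots (the frontier check is v1's `runFrontier`). -/
noncomputable def runRoots2 (n K : ℕ) (units : List ℕ) (roots : List (List ℕ)) : Bool :=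
  withTC n K units fun c => force popTable fun PT => tsearchRoots2 c PT roots

end STPP211T

end Summit.MatrixMultiplication.OmegaCensus
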